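import Mathlib
import Summits.Ventures.PercRepro2.Defs
import Summits.Ventures.PercRepro2.Independence
import Summits.Ventures.PercRepro2.Graph
import Summits.Ventures.PercRepro2.Induced
import Summits.Ventures.PercRepro2.BHKEvents
import Summits.Ventures.PercRepro2.HullDefs
import Summits.Ventures.PercRepro2.HullFlip
import Summits.Ventures.PercRepro2.HullTheoremA
import Summits.Ventures.PercRepro2.HullCount
import Summits.Ventures.PercRepro2.HullDom
import Summits.Ventures.PercRepro2.HullPieceFlip
import Summits.Ventures.PercRepro2.LocRows
import Summits.Ventures.PercRepro2.Loc0Dom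
import Summits.Ventures.PercRepro2.LocUDom2

/-!
# Row 2′LOC in its `C_B(l)`-local form (LOC0-BL): the name of record and its consequences
(blind cell PercRepro2, typer-1 g8; lead ASSIGNMENTS v11.35 (58): the statement of record for
row 2′LOC is `LocRows.LocU ends l h {S | o ∈ S}`; the piece-local `LocRows.Loc0` is refuted from
`n = 8` (NEG-64) and stays in the tree as a conditional form only)

* `LocRows.Loc0BL l h o := LocU ends l h {S | o ∈ S}`: an injection `M₀ → P₀` (with
  `M₀ = {h ∉ H_l, o ∈ B_side}`, `P₀ = {h ∉ H_l, o ∈ R_side}`) that recolours only edges touching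
  the blue cluster `C_B(l)` of the source — `srcU_setOf_mem` / `tgtU_setOf_mem` identify the
  (LOC-𝓤) sides at `𝓤 = {S ∣ o ∈ S}` with `src0` / `tgt0` of `LocRows`;
* `loc0BL_of_loc0`: the piece-local form implies the `C_B(l)`-local form (the piece of a
  blue-side vertex lies in `C_B(l)`), so every conditional theorem of `Loc0Dom` is a corollary
  of its (LOC0-BL) version;
* the consequences, on top of `LocUDom2.domSumG_univ_nonneg_of_locU` (p1: row 2′DOM on the free
  fibre under the BL-local injection): `Hull.domSumG_univ_nonneg_of_loc0BL`,
  `Hull.domFunG_univ_nonneg_of_loc0BL` (increasing functionals) and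
  `Hull.hullSumG_univ_nonneg_of_loc0BL` (the (BASE) instance `𝒰 = {S ∣ b ∈ S}`, i.e. the free-fibre
  hull sum of `HullCount`) — the statements of `Loc0Dom` with the hypothesis of record.
-/

namespace Summit.Ventures.PercRepro2

open scoped Classical

variable {V : Type*} {E : Type*} [Fintype E] [DecidableEq E]
  {R : Type*} [Field R] [LinearOrder R] [IsStrictOrderedRing R]

variable (ends : E → Sym2 V)

namespace LocRows

open Hull

/-- **(LOC0-BL)** — the statement of record for row 2′LOC: the `b`-free principal case
`𝓤 = {S ∣ o ∈ S}` of (LOC-𝓤), an injection `M₀ → P₀` recolouring only edges touching the blue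
cluster `C_B(l)` of the source configuration. -/
def Loc0BL (l h o : V) : Prop := LocU ends l h {S | o ∈ S}

/-- The (LOC-𝓤) source at `𝓤 = {S ∣ o ∈ S}` is `M₀`. -/
lemma srcU_setOf_mem (l h o : V) : srcU ends l h {S | o ∈ S} = src0 ends l h o := by
  ext ζ
  simp [srcU, src0, mem_bside_iff]

/-- The (LOC-𝓤) target at `𝓤 = {S ∣ o ∈ S}` is `P₀`. -/
lemma tgtU_setOf_mem (l h o : V) : tgtU ends l h {S | o ∈ S} = tgt0 ends l h o := by
  ext ζ
  simp [tgtU, tgt0, mem_rside_iff]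

/-- **(LOC0) implies (LOC0-BL)**: a `P_o`-local injection is `C_B(l)`-local, because the piece of a
blue-side vertex lies in `C_B(l)`. -/
theorem loc0BL_of_loc0 (l h o : V) (hl : Loc0 ends l h o) : Loc0BL ends l h o := by
  obtain ⟨f, hf, hmem⟩ := hl
  have hs : ∀ ζ, ζ ∈ srcU ends l h {S | o ∈ S} → ζ ∈ src0 ends l h o := fun ζ hζ => by
    rwa [srcU_setOf_mem] at hζ
  refine ⟨fun x => f ⟨x.1, hs x.1 x.2⟩, ?_, ?_⟩
  · intro x y hxy
    have hv := congrArg Subtype.val (hf hxy)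
    exact Subtype.ext hv
  · intro x
    obtain ⟨ht, hloc⟩ := hmem ⟨x.1, hs x.1 x.2⟩
    refine ⟨by rw [tgtU_setOf_mem]; exact ht, ?_⟩
    have ho : o ∈ bside ends x.1 l := (Finset.mem_filter.1 (hs x.1 x.2)).2.2
    intro e he
    exact touches_mono (Hull.piece_subset_cluster_blue ho) (hloc e he)

end LocRows

namespace Hull

/-- **(LOC0-BL) gives row 2′DOM on the free fibre**: for every up-set `𝒰` of vertex sets,
`Σ_ζ s_{o,l}(ζ) · 1[h ∉ H_l] · 1[C_B(h) ∈ 𝒰] ≥ 0`. -/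
theorem domSumG_univ_nonneg_of_loc0BL {l h o : V} (hl : LocRows.Loc0BL ends l h o) (z : Config E)
    {𝒰 : Set (Set V)} (h𝒰 : IsUpperSet 𝒰) :
    0 ≤ domSumG R ends Finset.univ z l o h 𝒰 :=
  domSumG_univ_nonneg_of_locU ends hl z h𝒰

/-- **(LOC0-BL) gives the increasing-functional form of row 2′DOM on the free fibre** (for monotone
`f` on a finite vertex type; layer cake + the colour swap, as in `HullDom`). -/
theorem domFunG_univ_nonneg_of_loc0BL [Fintype V] {l h o : V} (hl : LocRows.Loc0BL ends l h o)
    (z : Config E) (f : Set V → R) (hf : Monotone f) :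
    0 ≤ domFunG R ends Finset.univ z l o h f := by
  have hsplit : domFunG R ends Finset.univ z l o h f =
      domFunG R ends Finset.univ z l o h (fun S => f S - f ∅) +
        domFunG R ends Finset.univ z l o h (fun _ => f ∅) := by
    rw [← domFunG_add]
    congr 1
    funext S
    ring
  rw [hsplit, domFunG_const, add_zero]
  refine Lambda.nonneg_of_upperSet_indicators (domFunG R ends Finset.univ z l o h)
    (domFunG_add ends Finset.univ z l o h) (domFunG_smul ends Finset.univ z l o h)
    (fun 𝒰 h𝒰 => by
      rw [← domSumG_eq_indicator]
      exact domSumG_univ_nonneg_of_loc0BL ends hl z h𝒰) _ _ ?_ ?_ rfl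
  · intro S T hST
    exact sub_le_sub_right (hf hST) _
  · intro S
    exact sub_nonneg.2 (hf (Set.empty_subset S))

/-- **(LOC0-BL) gives the (BASE) instance on the free fibre**: the hull sum of `HullCount` at
`G = univ` (`𝒰 = {S ∣ b ∈ S}`) is nonnegative for every `b`. -/
theorem hullSumG_univ_nonneg_of_loc0BL {l h o : V} (hl : LocRows.Loc0BL ends l h o) (z : Config E)
    (b : V) : 0 ≤ hullSumG R ends Finset.univ z l o h b := by
  rw [hullSumG_eq_domSumG]
  exact domSumG_univ_nonneg_of_loc0BL ends hl z (isUpperSet_mem b)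

end Hull

end Summit.Ventures.PercRepro2
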